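import Summits.ABC.IUTFork.Cor312ProvK
import Literature.IUT.HodgeTheaters.InitialThetaDataQParamRootValuationProofs
import HarnessLib

/-!
# [IUTchIII] Cor. 3.12 provenance over `K` — [IUTchI] Ex. 3.2 (iv) AS A THEOREM of the typed data: `2l ∣ ord_w(q)` for the `K`-level
# Dupuy–Hilado pilot datum of every initial Θ-datum, hence realising q- and Θ-ideles over `K` EXIST (repair R1 of FINDING C-cert-3-F1)

PROOF-ONLY companion (no `def`) of `Cor312ProvK.lean` (abc-iut-C-cert-3, p434046; C-lead ruling C-R16 (b)). `Cor312ProvK` §4 names the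
divisibility `TwoMulLDvdOrdq X` («`2l ∣ ord_w(q_w)` on `S`», [IUTchI] Ex. 3.2 (iv): the valuation of `q̲ = q^{1/2l}` is attained) and proves that
UNDER it abc-iut-c312-3's realising ideles exist. THIS file DISCHARGES it at `X := pilotDataOfK D K`, the pilot datum of `D` over the Θ-datum's
OWN `K = F(E_F[l])`: the tree's typed consequences of [IUTchI] Def. 3.1 (b),(c) (abc-iut-w5-d158 / S2 lineage,
`InitialThetaData.two_mul_dvd_ordMinimalDiscriminant_baseChange`: `2l ∣ ord_w(Δ_min(E_K))` at every prime `w` of `K` over `𝕍(F)^bad`, with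
`hasMultiplicativeReductionAt_baseChange`) composed with Tate's `ord_w(q) = ord_w(Δ_min(E_K)) = −ord_w(j_E)` at the multiplicative place
(`log_valuation_j_eq_ordMinimalDiscriminant_of_hasMultiplicativeReductionAt`, discharged in the tree). So C-R16 (b)'s permitted hypothesis `hK`
is NOT needed: **at the `K`-level pilot datum of EVERY initial Θ-datum, realising q- and Θ-ideles EXIST** — the exact negation of the
`F`-level situation of FINDING C-cert-3-F1 (`Conditional.SideVacuity.not_realising_qIdeles_of_isPilotDataOf`, p432420). Consumer: the v5
certificate `Conditional/AbcOfSGenuineK.lean` (its side-condition WITNESS `GenuineK.sideConditions_satisfiable_K`).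
Classical; nothing here bears on [IUTchIII] Cor. 3.12 or takes a side on any author. typed ≠ proved; instantiated ≠ endorsed.
[cite: Mochizuki2012, IUTchI Def. 3.1 (b),(c) p. 61, Ex. 3.2 (iv) p. 71] [cite: DupuyHilado2025, §3.4]
-/

noncomputable section

open Set Function NumberField IsDedekindDomain

namespace Summit.ABC.IUTFork.Cor312Prov

open Literature.IUT.LogVolume Literature.IUT.HodgeTheaters Thm311.Real


section ExampleThreeTwo

variable {F K Fbar : Type} [Field F] [NumberField F] [Field K] [NumberField K] [Algebra F K] [Field Fbar]
  [Algebra F Fbar] [Algebra K Fbar] {E : WeierstrassCurve F} [E.IsElliptic] {l : ℕ} {Pb : BadPlacePredicates K}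

/-- **`TwoMulLDvdOrdq (pilotDataOfK D K)` — PROVED.** For the Dupuy–Hilado pilot datum of `D` over the Θ-datum's own `K = F(E_F[l])`,
`2l ∣ ord_w(q)` at every `w ∈ S` ([IUTchI] Ex. 3.2 (iv) «`q̲_v := q_v^{1/2l} ∈ K_v̲`», here as the tree's THEOREM
`InitialThetaData.two_mul_dvd_ordMinimalDiscriminant_baseChange` — from Def. 3.1 (b),(c): `E_F[2l]`-structure of `K`, `w ∤ 2l` — composed with
Tate's `ord_w(q) = ord_w(Δ_min(E_K)) = −ord_w(j_E)` at the multiplicative place `w`). Hence (§4) realising q- and Θ-ideles over `K` EXIST for every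
initial Θ-datum — the `K`-level repair of FINDING C-cert-3-F1. [cite: Mochizuki2012, IUTchI Def. 3.1 (b),(c) p. 61, Ex. 3.2 (iv) p. 71] -/
theorem twoMulLDvdOrdq_pilotDataOfK (D : InitialThetaData F K Fbar E l Pb) : TwoMulLDvdOrdq (pilotDataOfK D K) := by
  intro w hw
  have hx : FinitePlace.mk (finBelow F K w) ∈ D.VFbad := (mem_pilotDataOfK_S_iff D K w).mp hw
  haveI : w.asIdeal.LiesOver (FinitePlace.mk (finBelow F K w)).maximalIdeal.asIdeal := by
    rw [FinitePlace.maximalIdeal_mk]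
    exact liesOver_finBelow F K w
  have hdvd := D.two_mul_dvd_ordMinimalDiscriminant_baseChange hx w
  have hmult := D.hasMultiplicativeReductionAt_baseChange hx w
  haveI : (E.baseChange K).IsElliptic := by
    unfold WeierstrassCurve.baseChange
    infer_instance
  have hlog := (E.baseChange K).log_valuation_j_eq_ordMinimalDiscriminant_of_hasMultiplicativeReductionAt w hmult
  have hj : (E.baseChange K).j = algebraMap F K E.j := E.map_j (algebraMap F K)
  have hordq : (pilotDataOfK D K).ordq w = ((E.baseChange K).ordMinimalDiscriminant w : ℤ) := by
    unfold PilotData.ordq ord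
    rw [show (pilotDataOfK D K).jE = algebraMap F K E.j from rfl, ← hj, neg_neg, hlog]
  rw [hordq, pilotDataOfK_l]
  exact_mod_cast hdvd

/-- **Realising q-ideles over `K` EXIST for the `K`-level pilot datum of every initial Θ-datum** (§4 fed by §5) — non-vacuity of the
side conditions `htq0`, `htq1`, `htq` of the `K`-level certificates. [cite: Mochizuki2012, IUTchI Ex. 3.2 (iv) p. 71] -/
theorem exists_realising_qIdeles_pilotDataOfK (D : InitialThetaData F K Fbar E l Pb) :
    ∃ tq : ∀ (pp : Nat.Primes) (x : (thetaIndex (pilotDataOfK D K)).Fibre (.inr pp)),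
        haveI : Fact (pp : ℕ).Prime := ⟨pp.2⟩; kOf (pilotDataOfK D K) pp.1 x,
      (∀ pp x, tq pp x ≠ 0) ∧
      (∀ (pp : Nat.Primes) (x : (thetaIndex (pilotDataOfK D K)).Fibre (.inr pp)),
          haveI : Fact (pp : ℕ).Prime := ⟨pp.2⟩; placeOf (pilotDataOfK D K) pp.1 x ∉ (pilotDataOfK D K).S → ‖tq pp x‖ = 1) ∧
        ∀ (pp : Nat.Primes) (x : (thetaIndex (pilotDataOfK D K)).Fibre (.inr pp)),
          haveI : Fact (pp : ℕ).Prime := ⟨pp.2⟩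
          Real.log ‖tq pp x‖ = -((pilotDataOfK D K).qPilot (placeOf (pilotDataOfK D K) pp.1 x)) *
            logNorm K (placeOf (pilotDataOfK D K) pp.1 x) / localDegree K (placeOf (pilotDataOfK D K) pp.1 x) :=
  exists_realising_qIdeles_of_twoMulLDvdOrdq (pilotDataOfK D K) (twoMulLDvdOrdq_pilotDataOfK D)

/-- **Realising Θ-ideles over `K` EXIST for the `K`-level pilot datum of every initial Θ-datum** (§4 fed by §5).
[cite: Mochizuki2012, IUTchI Ex. 3.2 (iv) p. 71] -/
theorem exists_realising_thetaIdeles_pilotDataOfK (D : InitialThetaData F K Fbar E l Pb) :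
    ∃ t : ∀ (pp : Nat.Primes) (_ : Fin (pilotDataOfK D K).lstar) (x : (thetaIndex (pilotDataOfK D K)).Fibre (.inr pp)),
        haveI : Fact (pp : ℕ).Prime := ⟨pp.2⟩; kOf (pilotDataOfK D K) pp.1 x,
      (∀ pp i x, t pp i x ≠ 0) ∧
      (∀ (pp : Nat.Primes) (i : Fin (pilotDataOfK D K).lstar) (x : (thetaIndex (pilotDataOfK D K)).Fibre (.inr pp)),
          haveI : Fact (pp : ℕ).Prime := ⟨pp.2⟩; placeOf (pilotDataOfK D K) pp.1 x ∉ (pilotDataOfK D K).S → ‖t pp i x‖ = 1) ∧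
        ∀ (pp : Nat.Primes) (i : Fin (pilotDataOfK D K).lstar) (x : (thetaIndex (pilotDataOfK D K)).Fibre (.inr pp)),
          haveI : Fact (pp : ℕ).Prime := ⟨pp.2⟩
          Real.log ‖t pp i x‖ = -((pilotDataOfK D K).thetaPilot i (placeOf (pilotDataOfK D K) pp.1 x)) *
            logNorm K (placeOf (pilotDataOfK D K) pp.1 x) / localDegree K (placeOf (pilotDataOfK D K) pp.1 x) :=
  exists_realising_thetaIdeles_of_twoMulLDvdOrdq (pilotDataOfK D K) (twoMulLDvdOrdq_pilotDataOfK D)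

end ExampleThreeTwo

end Summit.ABC.IUTFork.Cor312Prov

end
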